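import Literature.NumberTheory.LFunctions.HalaszMeanSquare
import Literature.NumberTheory.LFunctions.HalaszPartialSummation
import Literature.NumberTheory.LFunctions.TaoLogElliottUnimodular
import Mathlib.MeasureTheory.Integral.Prod
import HarnessLib

/-!
# Halász's theorem, IV: the `α`-integration and the completely multiplicative case

Fourth file of the proof of Halász's theorem in the Halász–Montgomery–Tenenbaum form
(`Literature.NumberTheory.Sieve.halaszMontgomeryTenenbaum`), following Granville–Soundararajan,
*Decay of mean values of multiplicative functions* (2003), §3b ((3.7)–(3.8)) and §4 ((4.1)–(4.3)),
for a completely multiplicative `g : ℕ → ℂ` with `|g| ≤ 1`.  With `S(y) = ∑_{n ≤ y} g(n)`,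
`A(y) = ∑_{n ≤ y} g̃(n) log n` (`g̃` the `(⌊x⌋+1)`-smooth truncation, so `A(y) = ∑_{n ≤ y} g(n) log n`
for `y ≤ x`), `G(s) = ∑ g̃(n) n^{-s}`, `M = M(x,T) = min_{|t| ≤ T} 𝔻(g, n^{it}; x)²`:

* `integral_normSExp_le` — GS03 (3.7), one-sided: since `1/u ≤ 17 ∫_{1/(2 log x)}^1 e^{-2αu} dα`
  on `[log 2, log x]`, `∫_{log 2}^{log x} |S(e^u)| e^{-u} du ≤ 17 ∫_{α₀}^1 I(α) dα + log log x + 1`,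
  `I(α) = ∫_{log 2}^{log x} |A(e^u)| e^{-(1+2α)u} du` (Fubini on the rectangle);
* `inner_integral_le` — GS03 (3.8) with Lemma 3.2 (`HalaszMeanSquare.meanSquare_mulLog_le`):
  `I(α) ≤ 3B/α + 11e⁵/(√T₀ α²)` whenever `|G(1+α+iy)| ≤ B` on `|y| ≤ T₀` (Cauchy–Schwarz in `u`);
* `setIntegral_le_of_two_regimes` — the two-regime `α`-integration of (4.3);
* `norm_G_window_le`, `norm_G_shift_le` — (1.3)/(4.5) and (4.2): `|G(1+iu)| ≤ e⁵ log x · e^{-M}`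
  for `|u| ≤ T` (`HalaszEulerProduct.norm_G_one_line_le`), transported to `Re s = 1 + α` by the
  Poisson smoothing lemma (`PoissonSmoothing.norm_LSeries_le_of_bound`);
* `norm_S_le_of_completelyMultiplicative` — **Halász's theorem, completely multiplicative case,
  HMT form**: an absolute `K` with `|S(x)| ≤ K x ((1+M) e^{-M} + 1/√T)` for `x ≥ 3`, `T ≥ 4`
  (split at `α₁ = min(1, 1/B)`, `B = e⁵ log x · e^{-M}`; the term `log log x/log x` of GS03 is
  absorbed using `M ≤ log log x + 30`, `HalaszEulerProduct.exists_pretentiousDistSq_le`).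

The extension to multiplicative `f` (and the discharge of the named fact) is in
`Literature/NumberTheory/Sieve/HalaszMontgomeryTenenbaumProofs.lean`.

## References
- [GranvilleSoundararajan2003] A. Granville, K. Soundararajan, *Decay of mean values of
  multiplicative functions*, Canad. J. Math. 55 (2003): Lemma 2.1, (3.7)–(3.10), Lemma 3.2,
  §4 ((4.1)–(4.3)), Theorem 1 and Corollary 1.
- G. Tenenbaum, *Introduction to analytic and probabilistic number theory*, III.4 (the
  Halász–Montgomery–Tenenbaum form `≪ x(1+M)e^{-M} + x/√T`).

## Design choices
* All constants are explicit but crude (HMT only); `T ≥ 4` so that `T₀ = T/2 ≥ 2`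
  (the range `T < 4` is trivial and handled downstream); `x ≥ 3` throughout.
* Integrals in `u = log y` (no change of variables is ever performed); the rectangle
  `(α, u) ∈ (α₀, 1] × (log 2, log x]` carries a bounded measurable kernel, so Fubini applies.
-/

noncomputable section

open Finset Real Complex MeasureTheory Set Filter

namespace Literature.NumberTheory.LFunctions

namespace Halasz

open MellinPlancherel (psum)

variable {g : ℕ → ℂ}

/-! ### The logarithmically weighted sums `A(y) = ∑_{n ≤ y} g(n) log n` -/

/-- For `y ≤ N`, the partial sums of `g̃ log` are those of `g log`:
`∑_{n ≤ y} g̃(n) log n = ∑_{n ≤ y} g(n) log n`. [folklore] -/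
theorem psum_mulLog_eq_sum {N : ℕ} {y : ℝ} (hy : ⌊y⌋₊ ≤ N) :
    psum (mulLog g N) y = ∑ n ∈ Icc 1 ⌊y⌋₊, g n * (Real.log n : ℂ) := by
  unfold psum mulLog
  refine Finset.sum_congr rfl fun n hn => ?_
  simp only [Finset.mem_Icc] at hn
  rw [smoothCut_eq_self hn.1 (hn.2.trans hy)]

/-- **(A1) in logarithmic coordinates**: for `0 < u` with `e^u ≤ N + 1` (so `⌊e^u⌋ ≤ N`),
`|S(e^u)| e^{-u} ≤ |A(e^u)| e^{-u}/u + 1/u`, `A = psum (g̃ log)`.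
[cite: GranvilleSoundararajan2003, §2 (proof of Lemma 2.1, first display)] -/
theorem normSExp_le (hgb : ∀ n, ‖g n‖ ≤ 1) {N : ℕ} {u : ℝ} (hu : 0 < u)
    (huN : ⌊Real.exp u⌋₊ ≤ N) :
    normSExp g u ≤ ‖psum (mulLog g N) (Real.exp u)‖ * Real.exp (-u) / u + 1 / u := by
  unfold normSExp
  have h1 : (1 : ℝ) ≤ Real.exp u := by simpa using Real.one_le_exp hu.le
  have h := norm_S_mul_log_le_norm_sum hgb h1
  rw [Real.log_exp, ← psum_mulLog_eq_sum huN] at h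
  rw [← add_div, le_div_iff₀ hu]
  calc ‖S g (Real.exp u)‖ * Real.exp (-u) * u = ‖S g (Real.exp u)‖ * u * Real.exp (-u) := by ring
    _ ≤ (‖psum (mulLog g N) (Real.exp u)‖ + Real.exp u) * Real.exp (-u) := by gcongr
    _ = ‖psum (mulLog g N) (Real.exp u)‖ * Real.exp (-u) + 1 := by
        rw [add_mul, ← Real.exp_add, add_neg_cancel, Real.exp_zero]

/-- `∫_{α₀}^{1} e^{-2αu} dα = (e^{-2α₀u} - e^{-2u})/(2u)` for `u ≠ 0`. [folklore] -/
theorem integral_exp_neg_two_mul (α₀ : ℝ) {u : ℝ} (hu : u ≠ 0) :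
    ∫ α in α₀..1, Real.exp (-(2 * α * u)) =
      (Real.exp (-(2 * α₀ * u)) - Real.exp (-(2 * u))) / (2 * u) := by
  have hc : -(2 * u) ≠ 0 := by simpa using hu
  have hrw : ∀ α : ℝ, -(2 * α * u) = -(2 * u) * α := fun α => by ring
  simp_rw [hrw]
  rw [intervalIntegral.integral_comp_mul_left (f := Real.exp) hc, integral_exp, smul_eq_mul]
  field_simp
  ring_nf

/-- **The `α`-representation of `1/u`** (GS03 (3.7): `1/log y = 2∫_0^1 y^{-2α} dα + O(y^{-2}/log y)`;
here one-sided and on `α ∈ [1/(2 log x), 1]` only): for `log 2 ≤ u ≤ log x`,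
`1/u ≤ 17 ∫_{1/(2 log x)}^{1} e^{-2αu} dα`. [cite: GranvilleSoundararajan2003, (3.7)] -/
theorem inv_le_integral_exp {x u : ℝ} (hu2 : Real.log 2 ≤ u) (hux : u ≤ Real.log x) :
    1 / u ≤ 17 * ∫ α in (1 / (2 * Real.log x))..1, Real.exp (-(2 * α * u)) := by
  have hlog2 : (0.6931471803 : ℝ) < Real.log 2 := Real.log_two_gt_d9
  have hu : 0 < u := by linarith
  have hlx : 0 < Real.log x := by linarith
  rw [integral_exp_neg_two_mul _ hu.ne']
  -- `e^{-2α₀u} ≥ e^{-1}` and `e^{-2u} ≤ 1/4`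
  have hα₀u : 2 * (1 / (2 * Real.log x)) * u ≤ 1 := by
    rw [show 2 * (1 / (2 * Real.log x)) * u = u / Real.log x by field_simp]
    exact (div_le_one hlx).2 hux
  have h1 : Real.exp (-1) ≤ Real.exp (-(2 * (1 / (2 * Real.log x)) * u)) :=
    Real.exp_le_exp.2 (by linarith)
  have h2 : Real.exp (-(2 * u)) ≤ 1 / 4 := by
    have : Real.exp (-(2 * u)) ≤ Real.exp (-(2 * Real.log 2)) := Real.exp_le_exp.2 (by linarith)
    refine this.trans (le_of_eq ?_)
    rw [show -(2 * Real.log 2) = Real.log ((2:ℝ) ^ 2)⁻¹ by rw [Real.log_inv, Real.log_pow]; ring,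
      Real.exp_log (by positivity)]
    norm_num
  have he : (0.3677 : ℝ) ≤ Real.exp (-1) := by
    rw [Real.exp_neg]
    have := Real.exp_one_lt_d9
    rw [le_inv_comm₀ (by norm_num) (Real.exp_pos 1)]
    linarith
  rw [div_le_iff₀ hu, mul_comm (17:ℝ), mul_assoc, div_mul_eq_mul_div]
  rw [le_div_iff₀ (by positivity)]
  nlinarith


/-! ### The kernel `K(α, u) = |A(e^u)| e^{-(1+2α)u}` on the rectangle -/

/-- Crude growth: `|A(y)| ≤ y log y` for `y ≥ 1`. [folklore] -/
theorem norm_psum_mulLog_le_mul_log (hgb : ∀ n, ‖g n‖ ≤ 1) (N : ℕ) {y : ℝ} (hy : 1 ≤ y) :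
    ‖psum (mulLog g N) y‖ ≤ y * Real.log y := by
  have hy0 : 0 ≤ y := by linarith
  refine (MellinPlancherel.norm_psum_le _ _).trans ?_
  calc ∑ n ∈ Icc 1 ⌊y⌋₊, ‖mulLog g N n‖ ≤ ∑ n ∈ Icc 1 ⌊y⌋₊, Real.log y := by
        refine Finset.sum_le_sum fun n hn => (norm_mulLog_le hgb n).trans ?_
        simp only [Finset.mem_Icc] at hn
        have hn0 : (0 : ℝ) < n := by exact_mod_cast hn.1
        exact Real.log_le_log hn0 ((Nat.cast_le.2 hn.2).trans (Nat.floor_le hy0))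
    _ = ⌊y⌋₊ * Real.log y := by rw [Finset.sum_const, Nat.card_Icc, nsmul_eq_mul]; simp
    _ ≤ y * Real.log y := by gcongr; exacts [Real.log_nonneg hy, Nat.floor_le hy0]

/-- The kernel is measurable on `ℝ × ℝ` (coordinates `(α, u)`). [folklore] -/
theorem measurable_kernel (N : ℕ) :
    Measurable fun p : ℝ × ℝ =>
      ‖psum (mulLog g N) (Real.exp p.2)‖ * Real.exp (-((1 + 2 * p.1) * p.2)) := by
  refine Measurable.mul ?_ ?_
  · exact ((MellinPlancherel.measurable_psum _).comp (Real.measurable_exp.comp measurable_snd)).norm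
  · exact (Real.measurable_exp.comp (by fun_prop))

/-- On the rectangle `α ∈ (α₀, 1]`, `u ∈ (log 2, log x]` (`α₀ ≥ 0`, `x ≥ 1`), the kernel is
bounded by `x log x`. [folklore] -/
theorem kernel_le (hgb : ∀ n, ‖g n‖ ≤ 1) (N : ℕ) {x α₀ : ℝ} (hx : 1 ≤ x) (hα₀ : 0 ≤ α₀)
    {p : ℝ × ℝ} (hp : p ∈ Set.Ioc α₀ 1 ×ˢ Set.Ioc (Real.log 2) (Real.log x)) :
    ‖‖psum (mulLog g N) (Real.exp p.2)‖ * Real.exp (-((1 + 2 * p.1) * p.2))‖ ≤ x * Real.log x := by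
  obtain ⟨⟨hα1, -⟩, ⟨hu1, hu2⟩⟩ := hp
  have hlog2 : 0 < Real.log 2 := Real.log_pos (by norm_num)
  have hu0 : 0 < p.2 := hlog2.trans hu1
  have hx0 : 0 < x := by linarith
  have hexu : Real.exp p.2 ≤ x := by
    calc Real.exp p.2 ≤ Real.exp (Real.log x) := Real.exp_le_exp.2 hu2
      _ = x := Real.exp_log hx0
  rw [Real.norm_of_nonneg (by positivity)]
  have h1 : ‖psum (mulLog g N) (Real.exp p.2)‖ ≤ x * Real.log x := by
    refine (norm_psum_mulLog_le_mul_log hgb N (by simpa using Real.one_le_exp hu0.le)).trans ?_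
    rw [Real.log_exp]
    gcongr
  have hxl : 0 ≤ x * Real.log x := by have := Real.log_nonneg hx; positivity
  have h2 : Real.exp (-((1 + 2 * p.1) * p.2)) ≤ 1 := by
    rw [Real.exp_le_one_iff]
    have : 0 ≤ (1 + 2 * p.1) * p.2 := by
      have : 0 ≤ p.1 := hα₀.trans hα1.le
      positivity
    linarith
  calc ‖psum (mulLog g N) (Real.exp p.2)‖ * Real.exp (-((1 + 2 * p.1) * p.2))
      ≤ x * Real.log x * 1 := by gcongr
    _ = x * Real.log x := mul_one _

/-- The kernel is integrable on the rectangle `(α₀, 1] × (log 2, log x]`. [folklore] -/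
theorem integrable_kernel (hgb : ∀ n, ‖g n‖ ≤ 1) (N : ℕ) {x α₀ : ℝ} (hx : 1 ≤ x) (hα₀ : 0 ≤ α₀) :
    Integrable (fun p : ℝ × ℝ =>
        ‖psum (mulLog g N) (Real.exp p.2)‖ * Real.exp (-((1 + 2 * p.1) * p.2)))
      ((volume.restrict (Set.Ioc α₀ 1)).prod
        (volume.restrict (Set.Ioc (Real.log 2) (Real.log x)))) := by
  rw [Measure.prod_restrict, ← Measure.volume_eq_prod]
  refine Measure.integrableOn_of_bounded (M := x * Real.log x) ?_
    (measurable_kernel N).aestronglyMeasurable ?_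
  · rw [Measure.volume_eq_prod, Measure.prod_prod]
    exact ENNReal.mul_ne_top measure_Ioc_lt_top.ne measure_Ioc_lt_top.ne
  · exact ae_restrict_of_forall_mem (measurableSet_Ioc.prod measurableSet_Ioc)
      fun p hp => kernel_le hgb N hx hα₀ hp

/-- **GS03 (3.7), one-sided**: for `x ≥ 3`, with `N = ⌊x⌋`, `A = ∑_{n ≤ ·} g̃(n) log n` and
`α₀ = 1/(2 log x)`,
`∫_{log 2}^{log x} |S(e^u)| e^{-u} du ≤ 17 ∫_{α₀}^{1} (∫_{log 2}^{log x} |A(e^u)| e^{-(1+2α)u} du) dα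
  + log log x + 1`. [cite: GranvilleSoundararajan2003, (3.7)] -/
theorem integral_normSExp_le (hgb : ∀ n, ‖g n‖ ≤ 1) {x : ℝ} (hx : 3 ≤ x) :
    ∫ u in Real.log 2..Real.log x, normSExp g u ≤
      17 * (∫ α in Set.Ioc (1 / (2 * Real.log x)) 1,
              ∫ u in Set.Ioc (Real.log 2) (Real.log x),
                ‖psum (mulLog g ⌊x⌋₊) (Real.exp u)‖ * Real.exp (-((1 + 2 * α) * u))) +
        (Real.log (Real.log x) + 1) := by
  set N : ℕ := ⌊x⌋₊ with hN
  set α₀ : ℝ := 1 / (2 * Real.log x) with hα₀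
  set S : Set ℝ := Set.Ioc α₀ 1 with hS
  set T : Set ℝ := Set.Ioc (Real.log 2) (Real.log x) with hT
  set K : ℝ → ℝ → ℝ := fun α u =>
    ‖psum (mulLog g N) (Real.exp u)‖ * Real.exp (-((1 + 2 * α) * u)) with hK
  have hlog2 : (0.6931471803 : ℝ) < Real.log 2 := Real.log_two_gt_d9
  have hlog2' : Real.log 2 < 0.6931471808 := Real.log_two_lt_d9
  have hx1 : (1 : ℝ) ≤ x := by linarith
  have hlx : Real.log 2 ≤ Real.log x := Real.log_le_log (by norm_num) (by linarith)
  have hlx3 : 1 < Real.log x := by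
    rw [← Real.log_exp 1]
    refine Real.log_lt_log (Real.exp_pos 1) ?_
    have := Real.exp_one_lt_d9
    linarith
  have hα₀0 : 0 ≤ α₀ := by rw [hα₀]; positivity
  -- integrability of the kernel in both orders
  have hKint := integrable_kernel hgb N hx1 hα₀0
  have hKint' : Integrable (Function.uncurry fun u α => K α u)
      ((volume.restrict T).prod (volume.restrict S)) := hKint.swap
  -- the function `u ↦ ∫_α K α u` is integrable on `T`
  have hIu : Integrable (fun u => ∫ α in S, K α u) (volume.restrict T) := by
    have := hKint'.integral_prod_left
    simpa [Function.uncurry] using this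
  -- pointwise bound on `T`
  have hpt : ∀ u ∈ Set.Icc (Real.log 2) (Real.log x),
      normSExp g u ≤ 17 * (∫ α in S, K α u) + 1 / u := by
    intro u hu
    have hu0 : 0 < u := by linarith [hu.1]
    have huN : ⌊Real.exp u⌋₊ ≤ N := by
      rw [hN]
      refine Nat.floor_le_floor ?_
      calc Real.exp u ≤ Real.exp (Real.log x) := Real.exp_le_exp.2 hu.2
        _ = x := Real.exp_log (by linarith)
    refine (normSExp_le hgb hu0 huN).trans ?_
    gcongr ?_ + _
    have hrep := inv_le_integral_exp (x := x) hu.1 hu.2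
    have hA0 : 0 ≤ ‖psum (mulLog g N) (Real.exp u)‖ * Real.exp (-u) := by positivity
    calc ‖psum (mulLog g N) (Real.exp u)‖ * Real.exp (-u) / u
        = ‖psum (mulLog g N) (Real.exp u)‖ * Real.exp (-u) * (1 / u) := by ring
      _ ≤ ‖psum (mulLog g N) (Real.exp u)‖ * Real.exp (-u) *
            (17 * ∫ α in (1 / (2 * Real.log x))..1, Real.exp (-(2 * α * u))) := by gcongr
      _ = 17 * ∫ α in α₀..1, ‖psum (mulLog g N) (Real.exp u)‖ * Real.exp (-u) *
            Real.exp (-(2 * α * u)) := by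
          rw [intervalIntegral.integral_const_mul]; ring
      _ = 17 * ∫ α in S, K α u := by
          rw [intervalIntegral.integral_of_le (by
            rw [hα₀]; rw [div_le_one (by positivity)]; linarith)]
          congr 1
          refine setIntegral_congr_fun measurableSet_Ioc fun α _ => ?_
          simp only [hK]
          rw [mul_assoc, ← Real.exp_add]
          congr 2
          ring
  -- integrate the pointwise bound
  have hnormInt := intervalIntegrable_normSExp hgb (Real.log 2) (Real.log x)
  have hinvInt : IntervalIntegrable (fun u : ℝ => 1 / u) volume (Real.log 2) (Real.log x) := by
    refine (continuousOn_const.div continuousOn_id fun u hu => ?_).intervalIntegrable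
    rw [Set.uIcc_of_le hlx] at hu
    exact (ne_of_gt (by linarith [hu.1] : (0:ℝ) < u))
  have hRint : IntervalIntegrable (fun u => 17 * (∫ α in S, K α u) + 1 / u) volume
      (Real.log 2) (Real.log x) := by
    refine IntervalIntegrable.add ?_ hinvInt
    rw [intervalIntegrable_iff_integrableOn_Ioc_of_le hlx]
    exact hIu.const_mul 17
  calc ∫ u in Real.log 2..Real.log x, normSExp g u
      ≤ ∫ u in Real.log 2..Real.log x, (17 * (∫ α in S, K α u) + 1 / u) :=
        intervalIntegral.integral_mono_on hlx hnormInt hRint hpt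
    _ = 17 * (∫ u in Real.log 2..Real.log x, ∫ α in S, K α u) +
          ∫ u in Real.log 2..Real.log x, 1 / u := by
        rw [intervalIntegral.integral_add ?_ hinvInt, intervalIntegral.integral_const_mul]
        rw [intervalIntegrable_iff_integrableOn_Ioc_of_le hlx]
        exact hIu.const_mul 17
    _ ≤ 17 * (∫ α in S, ∫ u in T, K α u) + (Real.log (Real.log x) + 1) := by
        gcongr ?_ + ?_
        · refine le_of_eq ?_
          congr 1
          rw [intervalIntegral.integral_of_le hlx]
          exact integral_integral_swap hKint'
        · rw [integral_one_div_of_pos (by linarith) (by linarith), Real.log_div (by linarith) (by linarith)]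
          have : -1 ≤ Real.log (Real.log 2) := by
            rw [← Real.log_exp (-1)]
            refine Real.log_le_log (Real.exp_pos _) ?_
            rw [Real.exp_neg]
            have := Real.exp_one_gt_d9
            rw [inv_le_comm₀ (Real.exp_pos 1) (by linarith)]
            have h2 : (Real.log 2)⁻¹ ≤ 2 := by
              rw [inv_le_comm₀ (by linarith) (by norm_num)]; linarith
            linarith
          linarith


/-! ### Cauchy–Schwarz in `u` (GS03 (3.8)) and the mean square bound -/

/-- `∫_{(log 2, log x]} e^{-2αu} du ≤ 1/(2α)`. [folklore] -/
theorem setIntegral_exp_neg_le {x α : ℝ} (hα : 0 < α) :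
    ∫ u in Set.Ioc (Real.log 2) (Real.log x), Real.exp (-(2 * α) * u) ≤ 1 / (2 * α) := by
  have hIoi : IntegrableOn (fun u => Real.exp (-(2 * α) * u)) (Set.Ioi (Real.log 2)) :=
    integrableOn_exp_mul_Ioi (by linarith : -(2 * α) < 0) _
  calc ∫ u in Set.Ioc (Real.log 2) (Real.log x), Real.exp (-(2 * α) * u)
      ≤ ∫ u in Set.Ioi (Real.log 2), Real.exp (-(2 * α) * u) :=
        setIntegral_mono_set hIoi (Filter.Eventually.of_forall fun u => (Real.exp_pos _).le)
          Set.Ioc_subset_Ioi_self.eventuallyLE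
    _ = Real.exp (-(2 * α) * Real.log 2) / (2 * α) := by
        rw [integral_exp_mul_Ioi (by linarith : -(2 * α) < 0)]; ring
    _ ≤ 1 / (2 * α) := by
        gcongr
        rw [Real.exp_le_one_iff]
        have := Real.log_pos (show (1:ℝ) < 2 by norm_num)
        nlinarith

/-- The `J`-integrand is integrable over `ℝ` (from `A ∈ L²` after the exponential damping,
`MellinPlancherel.memLp_two_phi`). [folklore] -/
theorem integrable_meanSquare_integrand (hgb : ∀ n, ‖g n‖ ≤ 1) (N : ℕ) {α : ℝ} (hα : 0 < α) :
    Integrable fun u : ℝ =>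
      ‖psum (mulLog g N) (Real.exp u)‖ ^ 2 * Real.exp (-(2 * (1 + α) * u)) := by
  have hmem := MellinPlancherel.memLp_two_phi (a := mulLog g N) (σ := 1 + α) (θ := 1 + α / 2)
    (C := 2 / α) (fun y hy => norm_psum_mulLog_le hgb hα y hy) (by linarith)
  have hint := (memLp_two_iff_integrable_sq_norm hmem.1).1 hmem
  refine hint.congr (Filter.Eventually.of_forall fun u => ?_)
  simp only [MellinPlancherel.norm_phi]
  rw [mul_pow, ← Real.exp_nat_mul]
  ring_nf

/-- **GS03 (3.8) with Lemma 3.2** (completely multiplicative case, explicit): for `x ≥ 3`,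
`0 < α ≤ 1`, `T₀ ≥ 2` and `|G(1+α+iy)| ≤ B` (`|y| ≤ T₀`, `B ≥ 0`),
`∫_{log 2}^{log x} |A(e^u)| e^{-(1+2α)u} du ≤ 3B/α + 11 e⁵/(√T₀ α²)`.
[cite: GranvilleSoundararajan2003, (3.8) and Lemma 3.2] -/
theorem inner_integral_le (hg : ∀ m n, g (m * n) = g m * g n) (hg1 : g 1 = 1)
    (hgb : ∀ n, ‖g n‖ ≤ 1) {x : ℝ} (hx : 1 ≤ x) {α : ℝ} (hα : 0 < α) (hα1 : α ≤ 1)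
    {T₀ : ℝ} (hT₀ : 2 ≤ T₀) {B : ℝ} (hB0 : 0 ≤ B)
    (hB : ∀ y : ℝ, |y| ≤ T₀ → ‖LSeries (smoothCut g ⌊x⌋₊) (1 + α + y * I)‖ ≤ B) :
    ∫ u in Set.Ioc (Real.log 2) (Real.log x),
        ‖psum (mulLog g ⌊x⌋₊) (Real.exp u)‖ * Real.exp (-((1 + 2 * α) * u)) ≤
      3 * B / α + 11 * Real.exp 5 / (Real.sqrt T₀ * α ^ 2) := by
  set N : ℕ := ⌊x⌋₊ with hN
  set μ : Measure ℝ := volume.restrict (Set.Ioc (Real.log 2) (Real.log x)) with hμ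
  set f : ℝ → ℝ := fun u => ‖psum (mulLog g N) (Real.exp u)‖ * Real.exp (-((1 + α) * u)) with hf
  set h : ℝ → ℝ := fun u => Real.exp (-(α * u)) with hh
  have hT0 : 0 < T₀ := by linarith
  have hsT : 0 < Real.sqrt T₀ := Real.sqrt_pos.2 hT0
  -- the mean square bound from `HalaszMeanSquare`
  set Jb : ℝ := 18 * B ^ 2 / α + 223 * Real.exp 10 / (T₀ * α ^ 3) with hJb
  have hJ := meanSquare_mulLog_le hg hg1 hgb N hα hα1 hT₀ hB
  have hJb0 : 0 ≤ Jb := by positivity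
  -- the integrand is `f * h`
  have hfh : ∀ u, ‖psum (mulLog g N) (Real.exp u)‖ * Real.exp (-((1 + 2 * α) * u)) = f u * h u := by
    intro u
    simp only [hf, hh]
    rw [mul_assoc, ← Real.exp_add]
    congr 2
    ring
  simp_rw [hfh]
  -- measurability and bounds for Hölder
  have hfmeas : AEStronglyMeasurable f μ := by
    refine (Measurable.aestronglyMeasurable ?_)
    exact (((MellinPlancherel.measurable_psum _).comp Real.measurable_exp).norm).mul
      (Real.measurable_exp.comp (by fun_prop))
  have hhmeas : AEStronglyMeasurable h μ := (by fun_prop : Continuous h).aestronglyMeasurable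
  have hlog2 : 0 < Real.log 2 := Real.log_pos (by norm_num)
  have hfbd : ∀ᵐ u ∂μ, ‖f u‖ ≤ x * Real.log x := by
    refine ae_restrict_of_forall_mem measurableSet_Ioc fun u hu => ?_
    have h1 := kernel_le hgb N hx (by positivity : (0:ℝ) ≤ α / 4) (p := (α / 2, u))
      ⟨⟨by simp only; linarith, by simp only; linarith⟩, hu⟩
    simp only at h1
    simp only [hf]
    convert h1 using 4
    ring
  have hhbd : ∀ᵐ u ∂μ, ‖h u‖ ≤ 1 := by
    refine ae_restrict_of_forall_mem measurableSet_Ioc fun u hu => ?_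
    simp only [hh, Real.norm_eq_abs, abs_of_pos (Real.exp_pos _), Real.exp_le_one_iff]
    have : 0 < u := hlog2.trans hu.1
    nlinarith
  have hfmem : MemLp f (ENNReal.ofReal 2) μ := by
    rw [ENNReal.ofReal_ofNat]; exact MemLp.of_bound hfmeas _ hfbd
  have hhmem : MemLp h (ENNReal.ofReal 2) μ := by
    rw [ENNReal.ofReal_ofNat]; exact MemLp.of_bound hhmeas _ hhbd
  have hH := integral_mul_le_Lp_mul_Lq_of_nonneg Real.HolderConjugate.two_two
    (Filter.Eventually.of_forall fun u => by positivity)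
    (Filter.Eventually.of_forall fun u => (Real.exp_pos _).le) hfmem hhmem
  -- bound the two factors
  have hf2 : ∫ u, f u ^ (2:ℝ) ∂μ ≤ Jb := by
    simp_rw [Real.rpow_two]
    have hint := integrable_meanSquare_integrand hgb N hα
    have heq : ∀ u, f u ^ 2 = ‖psum (mulLog g N) (Real.exp u)‖ ^ 2 * Real.exp (-(2 * (1 + α) * u)) := by
      intro u
      simp only [hf]
      rw [mul_pow, ← Real.exp_nat_mul]
      congr 2
      push_cast
      ring
    simp_rw [heq]
    exact (setIntegral_le_integral hint (Filter.Eventually.of_forall fun u => by positivity)).trans hJ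
  have hh2 : ∫ u, h u ^ (2:ℝ) ∂μ ≤ 1 / (2 * α) := by
    simp_rw [Real.rpow_two]
    have heq : ∀ u, h u ^ 2 = Real.exp (-(2 * α) * u) := by
      intro u
      simp only [hh]
      rw [← Real.exp_nat_mul]
      congr 1
      push_cast
      ring
    simp_rw [heq]
    exact setIntegral_exp_neg_le hα
  have hf2_0 : 0 ≤ ∫ u, f u ^ (2:ℝ) ∂μ := integral_nonneg fun u => by positivity
  have hh2_0 : 0 ≤ ∫ u, h u ^ (2:ℝ) ∂μ := integral_nonneg fun u => by positivity
  -- combine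
  have hE0 : 0 ≤ 11 * Real.exp 5 / (Real.sqrt T₀ * α ^ 2) := by positivity
  calc ∫ u, f u * h u ∂μ
      ≤ (∫ u, f u ^ (2:ℝ) ∂μ) ^ (1 / (2:ℝ)) * (∫ u, h u ^ (2:ℝ) ∂μ) ^ (1 / (2:ℝ)) := hH
    _ ≤ Jb ^ (1 / (2:ℝ)) * (1 / (2 * α)) ^ (1 / (2:ℝ)) := by
        gcongr
    _ = Real.sqrt (Jb * (1 / (2 * α))) := by
        rw [Real.sqrt_eq_rpow, Real.mul_rpow hJb0 (by positivity)]
    _ ≤ 3 * B / α + 11 * Real.exp 5 / (Real.sqrt T₀ * α ^ 2) := by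
        rw [Real.sqrt_le_left (by positivity)]
        have hsq : Real.sqrt T₀ ^ 2 = T₀ := Real.sq_sqrt hT0.le
        have hexp : Real.exp 10 = Real.exp 5 ^ 2 := by rw [← Real.exp_nat_mul]; norm_num
        rw [hJb, hexp]
        have hkey : (18 * B ^ 2 / α + 223 * Real.exp 5 ^ 2 / (T₀ * α ^ 3)) * (1 / (2 * α)) =
            (3 * B / α) ^ 2 + (223 / 242) * (11 * Real.exp 5 / (Real.sqrt T₀ * α ^ 2)) ^ 2 := by
          field_simp
          rw [hsq]
          ring
        rw [hkey]
        have hB' : 0 ≤ 3 * B / α := by positivity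
        nlinarith [mul_nonneg hB' hE0, sq_nonneg (11 * Real.exp 5 / (Real.sqrt T₀ * α ^ 2))]


/-! ### Integration in `α` (GS03 §4, (4.3)): splitting at `α₁` -/

/-- `∫_a^b dα/α² = 1/a - 1/b` for `0 < a ≤ b`. [folklore] -/
theorem integral_one_div_sq {a b : ℝ} (ha : 0 < a) (hab : a ≤ b) :
    ∫ α in a..b, 1 / α ^ 2 = 1 / a - 1 / b := by
  have hderiv : ∀ α ∈ Set.uIcc a b, HasDerivAt (fun α : ℝ => -α⁻¹) (1 / α ^ 2) α := by
    intro α hα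
    rw [Set.uIcc_of_le hab] at hα
    have hα0 : α ≠ 0 := ne_of_gt (ha.trans_le hα.1)
    have := (hasDerivAt_inv hα0).neg
    simpa [one_div, Pi.neg_def] using this
  have hint : IntervalIntegrable (fun α : ℝ => 1 / α ^ 2) volume a b := by
    refine (continuousOn_const.div (continuousOn_id.pow 2) fun α hα => ?_).intervalIntegrable
    rw [Set.uIcc_of_le hab] at hα
    exact pow_ne_zero 2 (ne_of_gt (ha.trans_le hα.1))
  rw [intervalIntegral.integral_eq_sub_of_hasDerivAt hderiv hint]
  simp [one_div]
  ring

/-- **The two-regime `α`-integration** (GS03 (4.3): "employing the bound (4.2) when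
`α ≤ 1/(L log x)`, and the bound (4.1) when `1/(L log x) ≤ α ≤ 1`"), abstract form: if
`I(α) ≤ P/α + c + E/α²` on `[α₀, α₁]` and `I(α) ≤ Q/α²` on `[α₁, 1]` (`0 < α₀ ≤ α₁ ≤ 1`, nonnegative
constants), then `∫_{α₀}^1 I ≤ P log(α₁/α₀) + c + E/α₀ + Q/α₁`.
[cite: GranvilleSoundararajan2003, (4.3)] -/
theorem setIntegral_le_of_two_regimes {I : ℝ → ℝ} {α₀ α₁ : ℝ} (h0 : 0 < α₀) (h01 : α₀ ≤ α₁)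
    (h1 : α₁ ≤ 1) (hI : IntegrableOn I (Set.Ioc α₀ 1)) {P c E Q : ℝ} (hc : 0 ≤ c)
    (hE : 0 ≤ E) (hQ : 0 ≤ Q)
    (hb1 : ∀ α ∈ Set.Icc α₀ α₁, I α ≤ P / α + c + E / α ^ 2)
    (hb2 : ∀ α ∈ Set.Icc α₁ 1, I α ≤ Q / α ^ 2) :
    ∫ α in Set.Ioc α₀ 1, I α ≤ P * Real.log (α₁ / α₀) + c + E / α₀ + Q / α₁ := by
  have hα1 : 0 < α₁ := h0.trans_le h01
  have hI01 : IntervalIntegrable I volume α₀ 1 := by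
    rw [intervalIntegrable_iff_integrableOn_Ioc_of_le (h01.trans h1)]; exact hI
  have hIa : IntervalIntegrable I volume α₀ α₁ :=
    hI01.mono_set (by rw [Set.uIcc_of_le h01, Set.uIcc_of_le (h01.trans h1)];
                      exact Set.Icc_subset_Icc le_rfl h1)
  have hIb : IntervalIntegrable I volume α₁ 1 :=
    hI01.mono_set (by rw [Set.uIcc_of_le h1, Set.uIcc_of_le (h01.trans h1)];
                      exact Set.Icc_subset_Icc h01 le_rfl)
  -- the two majorants are continuous on the (positive) ranges
  have hcont1 : ContinuousOn (fun α : ℝ => P / α + c + E / α ^ 2) (Set.uIcc α₀ α₁) := by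
    rw [Set.uIcc_of_le h01]
    refine ContinuousOn.add (ContinuousOn.add ?_ continuousOn_const) ?_
    · exact continuousOn_const.div continuousOn_id fun α hα => ne_of_gt (h0.trans_le hα.1)
    · exact continuousOn_const.div (continuousOn_id.pow 2) fun α hα =>
        pow_ne_zero 2 (ne_of_gt (h0.trans_le hα.1))
  have hcont2 : ContinuousOn (fun α : ℝ => Q / α ^ 2) (Set.uIcc α₁ 1) := by
    rw [Set.uIcc_of_le h1]
    exact continuousOn_const.div (continuousOn_id.pow 2) fun α hα =>
      pow_ne_zero 2 (ne_of_gt (hα1.trans_le hα.1))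
  -- first range
  have hfirst : ∫ α in α₀..α₁, I α ≤ P * Real.log (α₁ / α₀) + c + E / α₀ := by
    calc ∫ α in α₀..α₁, I α ≤ ∫ α in α₀..α₁, (P / α + c + E / α ^ 2) :=
          intervalIntegral.integral_mono_on h01 hIa hcont1.intervalIntegrable hb1
      _ = P * Real.log (α₁ / α₀) + c * (α₁ - α₀) + E * (1 / α₀ - 1 / α₁) := by
          have hi1 : IntervalIntegrable (fun α : ℝ => P / α) volume α₀ α₁ :=
            (continuousOn_const.div continuousOn_id fun α hα => by
              rw [Set.uIcc_of_le h01] at hα; exact ne_of_gt (h0.trans_le hα.1)).intervalIntegrable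
          have hi2 : IntervalIntegrable (fun _ : ℝ => c) volume α₀ α₁ := intervalIntegrable_const
          have hi3 : IntervalIntegrable (fun α : ℝ => E / α ^ 2) volume α₀ α₁ :=
            (continuousOn_const.div (continuousOn_id.pow 2) fun α hα => by
              rw [Set.uIcc_of_le h01] at hα
              exact pow_ne_zero 2 (ne_of_gt (h0.trans_le hα.1))).intervalIntegrable
          rw [intervalIntegral.integral_add (hi1.add hi2) hi3, intervalIntegral.integral_add hi1 hi2,
            intervalIntegral.integral_const, smul_eq_mul]
          have e1 : ∫ α in α₀..α₁, P / α = P * Real.log (α₁ / α₀) := by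
            calc ∫ α in α₀..α₁, P / α = ∫ α in α₀..α₁, P * (1 / α) := by
                  congr 1; ext α; ring
              _ = P * Real.log (α₁ / α₀) := by
                  rw [intervalIntegral.integral_const_mul, integral_one_div_of_pos h0 hα1]
          have e3 : ∫ α in α₀..α₁, E / α ^ 2 = E * (1 / α₀ - 1 / α₁) := by
            have := integral_one_div_sq h0 h01
            calc ∫ α in α₀..α₁, E / α ^ 2 = ∫ α in α₀..α₁, E * (1 / α ^ 2) := by
                  congr 1; ext α; ring
              _ = E * (1 / α₀ - 1 / α₁) := by rw [intervalIntegral.integral_const_mul, this]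
          rw [e1, e3]; ring
      _ ≤ P * Real.log (α₁ / α₀) + c + E / α₀ := by
          have h1' : c * (α₁ - α₀) ≤ c := by nlinarith
          have h2' : E * (1 / α₀ - 1 / α₁) ≤ E / α₀ := by
            have hα : 0 ≤ 1 / α₁ := by positivity
            have heq : E * (1 / α₀ - 1 / α₁) = E / α₀ - E * (1 / α₁) := by ring
            rw [heq]
            linarith [mul_nonneg hE hα]
          linarith
  -- second range
  have hsecond : ∫ α in α₁..1, I α ≤ Q / α₁ := by
    calc ∫ α in α₁..1, I α ≤ ∫ α in α₁..1, Q / α ^ 2 :=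
          intervalIntegral.integral_mono_on h1 hIb hcont2.intervalIntegrable hb2
      _ = Q * (1 / α₁ - 1 / 1) := by
          have := integral_one_div_sq hα1 h1
          calc ∫ α in α₁..1, Q / α ^ 2 = ∫ α in α₁..1, Q * (1 / α ^ 2) := by
                congr 1; ext α; ring
            _ = Q * (1 / α₁ - 1 / 1) := by rw [intervalIntegral.integral_const_mul, this]
      _ ≤ Q / α₁ := by
          have heq : Q * (1 / α₁ - 1 / 1) = Q / α₁ - Q := by ring
          rw [heq]; linarith
  rw [← intervalIntegral.integral_of_le (h01.trans h1),
    ← intervalIntegral.integral_add_adjacent_intervals hIa hIb]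
  linarith

/-! ### Auxiliary real inequalities

(`u ↦ (1+u)e^{-u}` is non-increasing on `[0,∞)`: `Tao2016.one_add_mul_exp_neg_le`,
`TaoLogElliottUnimodular.lean`.) -/

/-- For `x ≥ 3` and `0 ≤ M ≤ log log x + 30`: `(1 + log log x)/log x ≤ e^{30} (1+M) e^{-M}`.
[folklore] -/
theorem one_add_loglog_div_le {x M : ℝ} (hx : 3 ≤ x) (hM : 0 ≤ M)
    (hMle : M ≤ Real.log (Real.log x) + 30) :
    (1 + Real.log (Real.log x)) / Real.log x ≤ Real.exp 30 * ((1 + M) * Real.exp (-M)) := by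
  have hlx : 1 < Real.log x := by
    rw [← Real.log_exp 1]
    exact Real.log_lt_log (Real.exp_pos 1) (by have := Real.exp_one_lt_d9; linarith)
  have hlx0 : 0 < Real.log x := by linarith
  have hll : 0 ≤ Real.log (Real.log x) := Real.log_nonneg hlx.le
  have hanti := Tao2016.one_add_mul_exp_neg_le hM hMle
  have hval : (1 + (Real.log (Real.log x) + 30)) * Real.exp (-(Real.log (Real.log x) + 30)) =
      (31 + Real.log (Real.log x)) * (Real.exp (-30) / Real.log x) := by
    rw [neg_add, Real.exp_add, Real.exp_neg (Real.log (Real.log x)), Real.exp_log hlx0]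
    ring
  rw [hval] at hanti
  have h30 : Real.exp 30 * Real.exp (-30) = 1 := by rw [← Real.exp_add]; simp
  calc (1 + Real.log (Real.log x)) / Real.log x
      ≤ (31 + Real.log (Real.log x)) / Real.log x := by gcongr; linarith
    _ = Real.exp 30 * ((31 + Real.log (Real.log x)) * (Real.exp (-30) / Real.log x)) := by
        rw [show Real.exp 30 * ((31 + Real.log (Real.log x)) * (Real.exp (-30) / Real.log x)) =
          (Real.exp 30 * Real.exp (-30)) * ((31 + Real.log (Real.log x)) / Real.log x) by ring,
          h30, one_mul]
    _ ≤ Real.exp 30 * ((1 + M) * Real.exp (-M)) := by gcongr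

/-! ### The window bound for `G` from the pretentious distance -/

open Literature.NumberTheory.Sieve (minPretentiousDistSq pretentiousDistSq)

/-- `M(x,T) ≤ 𝔻(g, n^{it}; x)²` for `|t| ≤ T`. [folklore] -/
theorem minPretentiousDistSq_le_of_abs_le (hgb : ∀ n, ‖g n‖ ≤ 1) (x : ℝ) {T t : ℝ} (ht : |t| ≤ T) :
    minPretentiousDistSq g x T ≤ pretentiousDistSq g (fun n : ℕ => (n : ℂ) ^ ((t : ℂ) * I)) x := by
  unfold minPretentiousDistSq
  have hmem : t ∈ Set.Icc (-T) T := ⟨by linarith [neg_abs_le t, ht], (le_abs_self t).trans ht⟩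
  refine ciInf_le_of_le ?_ ⟨t, hmem⟩ le_rfl
  refine ⟨0, ?_⟩
  rintro _ ⟨s, rfl⟩
  refine Sieve.pretentiousDistSq_nonneg hgb (fun n => ?_) x
  rcases Nat.eq_zero_or_pos n with rfl | hn
  · rcases eq_or_ne ((((s : ℝ) : ℂ)) * I) 0 with h0 | h0
    · simp [h0]
    · simp [Complex.zero_cpow h0]
  · rw [Complex.norm_natCast_cpow_of_pos hn]; simp

/-- The averaging bound: `M(x, T) ≤ log log x + 30` for `x ≥ 3`, `T ≥ 1`
(`HalaszEulerProduct.exists_pretentiousDistSq_le`). [cite: GranvilleSoundararajan2003, §4] -/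
theorem minPretentiousDistSq_le_loglog (hgb : ∀ n, ‖g n‖ ≤ 1) {x T : ℝ} (hx : 3 ≤ x) (hT : 1 ≤ T) :
    minPretentiousDistSq g x T ≤ Real.log (Real.log x) + 30 := by
  obtain ⟨t, ht, hle⟩ := exists_pretentiousDistSq_le (g := g) hgb hx
  have htT : |t| ≤ T := by rw [abs_of_nonneg ht.1]; exact ht.2.trans hT
  exact (minPretentiousDistSq_le_of_abs_le hgb x htT).trans hle

/-- **The window** (GS03 (1.3) with (4.5)-type majorisation): for `|u| ≤ T`,
`|G(1+iu)| ≤ e⁵ log x · e^{-M(x,T)}`. [cite: GranvilleSoundararajan2003, (1.3) and (4.5)] -/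
theorem norm_G_window_le (hg : ∀ m n, g (m * n) = g m * g n) (hg1 : g 1 = 1)
    (hgb : ∀ n, ‖g n‖ ≤ 1) {x : ℝ} (hx : 3 ≤ x) {T u : ℝ} (hu : |u| ≤ T) :
    ‖LSeries (smoothCut g ⌊x⌋₊) (1 + u * I)‖ ≤
      Real.exp 5 * Real.log x * Real.exp (-minPretentiousDistSq g x T) := by
  refine (norm_G_one_line_le hg hg1 hgb hx u).trans ?_
  gcongr
  · exact mul_nonneg (Real.exp_pos _).le (Real.log_nonneg (by linarith))
  · exact minPretentiousDistSq_le_of_abs_le hgb x hu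

/-- **(4.2) via Poisson smoothing**: for `0 < α`, `T₀ > 0` and `|y| ≤ T₀`,
`|G(1+α+iy)| ≤ e⁵ log x · e^{-M(x, 2T₀)} + (2α/T₀) e⁵ log x`.
[cite: GranvilleSoundararajan2003, (4.2)] -/
theorem norm_G_shift_le (hg : ∀ m n, g (m * n) = g m * g n) (hg1 : g 1 = 1)
    (hgb : ∀ n, ‖g n‖ ≤ 1) {x : ℝ} (hx : 3 ≤ x) {α T₀ y : ℝ} (hα : 0 < α) (hT₀ : 0 < T₀)
    (hy : |y| ≤ T₀) :
    ‖LSeries (smoothCut g ⌊x⌋₊) (1 + α + y * I)‖ ≤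
      Real.exp 5 * Real.log x * Real.exp (-minPretentiousDistSq g x (2 * T₀)) +
        2 * α / T₀ * (Real.exp 5 * Real.log x) := by
  obtain ⟨hsum, hS⟩ := tsum_norm_term_one_le (g := g) hgb hx
  have hP := PoissonSmoothing.norm_LSeries_le_of_bound (α := α) hα (a := smoothCut g ⌊x⌋₊)
    (σ₀ := 1) hsum hT₀ y
    (B := Real.exp 5 * Real.log x * Real.exp (-minPretentiousDistSq g x (2 * T₀)))
    (fun u hu => by
      have := norm_G_window_le hg hg1 hgb hx (T := 2 * T₀) (u := u) (by linarith)
      simpa using this)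
  push_cast at hP
  refine hP.trans ?_
  gcongr


/-! ### Halász's theorem for completely multiplicative functions -/

/-- `1/min(1, 1/B) ≤ 1 + B` for `B > 0`. [folklore] -/
theorem one_div_min_le {B : ℝ} (hB : 0 < B) : 1 / min 1 (1 / B) ≤ 1 + B := by
  rcases le_or_gt 1 (1 / B) with h | h
  · rw [min_eq_left h]; linarith
  · rw [min_eq_right h.le, one_div_one_div]; linarith

set_option maxHeartbeats 800000 in
-- one long bookkeeping proof (six term estimates); the default budget is too small
/-- **Halász's theorem in the Halász–Montgomery–Tenenbaum form, completely multiplicative case**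
(Granville–Soundararajan 2003, Theorem 1 and Corollary 1, in the cruder shape
`|S(x)| ≪ x((1+M) e^{-M} + 1/√T)`, `M = min_{|t| ≤ T} 𝔻(g, n^{it}; x)²`): there is an absolute `K`
such that for every completely multiplicative `g` with `|g| ≤ 1`, all `x ≥ 3` and `T ≥ 4`,
`|∑_{n ≤ x} g(n)| ≤ K x ((1 + M) e^{-M} + 1/√T)`.
Proof: Lemma 2.1 (`HalaszPartialSummation`), the `α`-representation and Cauchy–Schwarz
(this file), the mean square bound (`HalaszMeanSquare`), the bounds (4.1)–(4.2) for `G` on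
`Re s = 1 + α` (`HalaszEulerProduct`, `PoissonSmoothing`) with the split at `α₁ = min(1, 1/B)`,
`B = e⁵ log x · e^{-M}`, and `M ≤ log log x + 30` to absorb `log log x / log x`.
[cite: GranvilleSoundararajan2003, Theorem 1 and Corollary 1 (§4)] -/
theorem norm_S_le_of_completelyMultiplicative :
    ∃ K : ℝ, 0 < K ∧ ∀ g : ℕ → ℂ, (∀ m n, g (m * n) = g m * g n) → g 1 = 1 →
      (∀ n, ‖g n‖ ≤ 1) → ∀ x T : ℝ, 3 ≤ x → 4 ≤ T →
        ‖S g x‖ ≤ K * x * ((1 + minPretentiousDistSq g x T) *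
          Real.exp (-minPretentiousDistSq g x T) + 1 / Real.sqrt T) := by
  obtain ⟨C₂, hC₂⟩ := exists_norm_S_mul_log_le_integral
  set e5 : ℝ := Real.exp 5 with he5
  set e10 : ℝ := Real.exp 10 with he10
  set e30 : ℝ := Real.exp 30 with he30
  set K : ℝ := 17 * (3 * e30 + 12 * e5 + 33 * e5 + (3 * e10 + 11 * e5) * (e30 + e5)) +
    e30 + |C₂| * e30 + e5 with hK
  have he5pos : 0 < e5 := Real.exp_pos _
  have he10pos : 0 < e10 := Real.exp_pos _
  have he30pos : 0 < e30 := Real.exp_pos _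
  have h530 : e5 ≤ e30 := Real.exp_le_exp.2 (by norm_num)
  have hKpos : 0 < K := by positivity
  have hKe5 : e5 ≤ K := by
    have : 0 ≤ 17 * (3 * e30 + 12 * e5 + 33 * e5 + (3 * e10 + 11 * e5) * (e30 + e5)) +
      e30 + |C₂| * e30 := by positivity
    linarith
  refine ⟨K, hKpos, ?_⟩
  intro g hg hg1 hgb x T hx hT
  set M : ℝ := minPretentiousDistSq g x T with hM
  set Φ : ℝ := (1 + M) * Real.exp (-M) with hΦ
  set ℓ : ℝ := Real.log x with hℓ
  have hx0 : 0 < x := by linarith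
  have hℓ1 : 1 < ℓ := by
    rw [hℓ, ← Real.log_exp 1]
    exact Real.log_lt_log (Real.exp_pos 1) (by have := Real.exp_one_lt_d9; linarith)
  have hℓ0 : 0 < ℓ := by linarith
  have hM0 : 0 ≤ M := Sieve.minPretentiousDistSq_nonneg hgb x (by linarith)
  have hMll : M ≤ Real.log ℓ + 30 := minPretentiousDistSq_le_loglog hgb hx (by linarith)
  have heM : 0 < Real.exp (-M) := Real.exp_pos _
  have hΦ0 : 0 ≤ Φ := by positivity
  have hll0 : 0 ≤ Real.log ℓ := Real.log_nonneg hℓ1.le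
  have hT0 : 0 < T := by linarith
  have hsqT : 0 < Real.sqrt T := Real.sqrt_pos.2 hT0
  have hA : (1 + Real.log ℓ) / ℓ ≤ e30 * Φ := one_add_loglog_div_le hx hM0 hMll
  have hA1 : 1 ≤ e30 * Φ * ℓ := by
    have : 1 / ℓ ≤ e30 * Φ := le_trans (by gcongr; linarith) hA
    rwa [div_le_iff₀ hℓ0] at this
  have hS0 : ‖S g x‖ ≤ x := norm_S_le' hgb hx0.le
  -- the trivial case `M < 5`
  by_cases hM5 : M < 5
  · have hΦ5 : 6 * Real.exp (-5) ≤ Φ := by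
      have := Tao2016.one_add_mul_exp_neg_le hM0 hM5.le
      norm_num at this ⊢
      linarith
    have h55 : e5 * Real.exp (-5) = 1 := by rw [he5, ← Real.exp_add]; simp
    calc ‖S g x‖ ≤ x := hS0
      _ = e5 / 6 * x * (6 * Real.exp (-5)) := by
          rw [show e5 / 6 * x * (6 * Real.exp (-5)) = (e5 * Real.exp (-5)) * x by ring, h55, one_mul]
      _ ≤ e5 / 6 * x * Φ := by gcongr
      _ ≤ K * x * (Φ + 1 / Real.sqrt T) := by
          have h1 : e5 / 6 ≤ K := by linarith
          have h2 : Φ ≤ Φ + 1 / Real.sqrt T := by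
            have : 0 ≤ 1 / Real.sqrt T := by positivity
            linarith
          gcongr
  push Not at hM5
  -- the main case `M ≥ 5`
  set Bw : ℝ := e5 * ℓ * Real.exp (-M) with hBw
  have hBw0 : 0 < Bw := by positivity
  have heM5 : Real.exp (-M) ≤ Real.exp (-5) := Real.exp_le_exp.2 (by linarith)
  have h55 : e5 * Real.exp (-5) = 1 := by rw [he5, ← Real.exp_add]; simp
  have hL1 : e5 * Real.exp (-M) ≤ 1 := by
    calc e5 * Real.exp (-M) ≤ e5 * Real.exp (-5) := by gcongr
      _ = 1 := h55
  have hBwℓ : Bw ≤ ℓ := by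
    calc Bw = (e5 * Real.exp (-M)) * ℓ := by rw [hBw]; ring
      _ ≤ 1 * ℓ := by gcongr
      _ = ℓ := one_mul ℓ
  set α₀ : ℝ := 1 / (2 * ℓ) with hα₀
  set α₁ : ℝ := min 1 (1 / Bw) with hα₁
  have hα₀0 : 0 < α₀ := by positivity
  have h1 : α₁ ≤ 1 := min_le_left _ _
  have h01 : α₀ ≤ α₁ := by
    refine le_min ?_ ?_
    · rw [hα₀, div_le_one (by positivity)]; linarith
    · rw [hα₀]; exact one_div_le_one_div_of_le hBw0 (by linarith)
  have hα₁0 : 0 < α₁ := hα₀0.trans_le h01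
  -- Halász II and the `α`-representation
  have hII := hC₂ g hg hgb x hx
  have hB1 := integral_normSExp_le (g := g) hgb hx
  set I : ℝ → ℝ := fun α => ∫ u in Set.Ioc (Real.log 2) (Real.log x),
    ‖psum (mulLog g ⌊x⌋₊) (Real.exp u)‖ * Real.exp (-((1 + 2 * α) * u)) with hI
  have hIint : IntegrableOn I (Set.Ioc α₀ 1) :=
    (integrable_kernel hgb ⌊x⌋₊ (x := x) (by linarith) hα₀0.le).integral_prod_left
  -- the two per-`α` bounds
  set E' : ℝ := 11 * e5 / Real.sqrt (T / 2) with hE'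
  have hsq2 : 0 < Real.sqrt (T / 2) := Real.sqrt_pos.2 (by linarith)
  have hE'0 : 0 ≤ E' := by positivity
  have hT22 : 2 * (T / 2) = T := by ring
  have hb1 : ∀ α ∈ Set.Icc α₀ α₁, I α ≤ 3 * Bw / α + 12 * e5 * ℓ / T + E' / α ^ 2 := by
    intro α hα
    have hα0' : 0 < α := hα₀0.trans_le hα.1
    have hα1' : α ≤ 1 := hα.2.trans h1
    have hB := inner_integral_le hg hg1 hgb (x := x) (by linarith) hα0' hα1' (T₀ := T / 2)
      (by linarith) (B := Bw + 2 * α / (T / 2) * (e5 * ℓ)) (by positivity) (fun y hy => by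
        have h := norm_G_shift_le hg hg1 hgb hx hα0' (T₀ := T / 2) (by linarith) hy
        rw [hT22] at h
        exact h)
    refine hB.trans (le_of_eq ?_)
    simp only [hE']
    field_simp
    ring
  have hb2 : ∀ α ∈ Set.Icc α₁ 1, I α ≤ (3 * e10 + E') / α ^ 2 := by
    intro α hα
    have hα0' : 0 < α := hα₁0.trans_le hα.1
    have hα1' : α ≤ 1 := hα.2
    have hB := inner_integral_le hg hg1 hgb (x := x) (by linarith) hα0' hα1' (T₀ := T / 2)
      (by linarith) (B := e10 / α) (by positivity) (fun y _ => by
        refine (norm_G_le_min hg hg1 hgb hx hα0' hα1' y).trans ?_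
        rw [he10]
        calc Real.exp 10 * min (Real.log x) (1 / α) ≤ Real.exp 10 * (1 / α) := by
              gcongr; exact min_le_right _ _
          _ = Real.exp 10 / α := by ring)
    refine hB.trans (le_of_eq ?_)
    simp only [hE']
    field_simp
    ring
  have hB3 := setIntegral_le_of_two_regimes hα₀0 h01 h1 hIint (P := 3 * Bw)
    (c := 12 * e5 * ℓ / T) (E := E') (Q := 3 * e10 + E') (by positivity) hE'0 (by positivity)
    hb1 hb2
  -- the common unit `W = (Φ + 1/√T) log x`
  set W : ℝ := (Φ + 1 / Real.sqrt T) * ℓ with hW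
  have hWeq : W = Φ * ℓ + ℓ / Real.sqrt T := by rw [hW]; ring
  have hΦW : Φ * ℓ ≤ W := by
    have : 0 ≤ ℓ / Real.sqrt T := by positivity
    linarith
  have hTW : ℓ / Real.sqrt T ≤ W := by
    have : 0 ≤ Φ * ℓ := by positivity
    linarith
  have hW0 : 0 ≤ W := by positivity
  -- `√T/√2 = √(T/2)`, `√2 < 3/2`, `√T ≤ T`
  have hsqrt_div : Real.sqrt (T / 2) = Real.sqrt T / Real.sqrt 2 := Real.sqrt_div' T (by norm_num)
  have hs2 : Real.sqrt 2 < 3 / 2 := (Real.sqrt_lt' (by norm_num)).2 (by norm_num)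
  have hs2pos : 0 < Real.sqrt 2 := Real.sqrt_pos.2 (by norm_num)
  have hsqT_le : Real.sqrt T ≤ T := by
    rw [Real.sqrt_le_left (by linarith)]; nlinarith
  have h1sq2 : 1 ≤ Real.sqrt (T / 2) := by
    rw [Real.le_sqrt (by norm_num) (by linarith)]; linarith
  -- t5: `log ℓ + 1 ≤ e30 W`
  have ht5 : Real.log ℓ + 1 ≤ e30 * W := by
    have : (1 + Real.log ℓ) ≤ e30 * Φ * ℓ := by
      have := hA; rwa [div_le_iff₀ hℓ0] at this
    calc Real.log ℓ + 1 = 1 + Real.log ℓ := by ring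
      _ ≤ e30 * (Φ * ℓ) := by linarith
      _ ≤ e30 * W := mul_le_mul_of_nonneg_left hΦW he30pos.le
  -- t6: `|C₂| ≤ |C₂| e30 W`
  have h1W : 1 ≤ e30 * W := by
    calc (1:ℝ) ≤ e30 * Φ * ℓ := hA1
      _ = e30 * (Φ * ℓ) := by ring
      _ ≤ e30 * W := mul_le_mul_of_nonneg_left hΦW he30pos.le
  have ht6 : |C₂| ≤ |C₂| * e30 * W := by
    have := mul_le_mul_of_nonneg_left h1W (abs_nonneg C₂)
    linarith
  -- t2: `12 e5 ℓ / T ≤ 12 e5 W`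
  have ht2 : 12 * e5 * ℓ / T ≤ 12 * e5 * W := by
    have : ℓ / T ≤ ℓ / Real.sqrt T := div_le_div_of_nonneg_left hℓ0.le hsqT hsqT_le
    calc 12 * e5 * ℓ / T = 12 * e5 * (ℓ / T) := by ring
      _ ≤ 12 * e5 * W := mul_le_mul_of_nonneg_left (this.trans hTW) (by positivity)
  -- t3: `E'/α₀ = 22 e5 ℓ √2/√T ≤ 33 e5 W`
  have ht3 : E' / α₀ ≤ 33 * e5 * W := by
    have hE'eq : E' / α₀ = 22 * e5 * Real.sqrt 2 * (ℓ / Real.sqrt T) := by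
      rw [hE', hα₀, hsqrt_div]; field_simp; ring
    rw [hE'eq]
    have h22 : (0:ℝ) ≤ 22 * e5 := by positivity
    have hℓT : 0 ≤ ℓ / Real.sqrt T := by positivity
    calc 22 * e5 * Real.sqrt 2 * (ℓ / Real.sqrt T) ≤ 22 * e5 * (3 / 2) * W :=
          mul_le_mul (mul_le_mul_of_nonneg_left hs2.le h22) hTW hℓT (by positivity)
      _ = 33 * e5 * W := by ring
  -- t4: `Q/α₁ ≤ (3 e10 + 11 e5)(e30 + e5) W`
  have hE'le : E' ≤ 11 * e5 := by
    rw [hE', div_le_iff₀ hsq2]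
    have := mul_le_mul_of_nonneg_left h1sq2 (by positivity : (0:ℝ) ≤ 11 * e5)
    linarith
  have hBwle : Bw ≤ e5 * W := by
    have hMe : Real.exp (-M) ≤ Φ := by
      have := mul_le_mul_of_nonneg_right (by linarith : (1:ℝ) ≤ 1 + M) heM.le
      rw [hΦ]; linarith
    calc Bw = e5 * (Real.exp (-M) * ℓ) := by rw [hBw]; ring
      _ ≤ e5 * (Φ * ℓ) := by gcongr
      _ ≤ e5 * W := by gcongr
  have ht4 : (3 * e10 + E') / α₁ ≤ (3 * e10 + 11 * e5) * (e30 + e5) * W := by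
    have hinv : 1 / α₁ ≤ 1 + Bw := one_div_min_le hBw0
    have h1B : 1 + Bw ≤ (e30 + e5) * W := by linarith
    have hq0 : 0 ≤ 3 * e10 + E' := by positivity
    have hi0 : 0 ≤ 1 / α₁ := by positivity
    calc (3 * e10 + E') / α₁ = (3 * e10 + E') * (1 / α₁) := by ring
      _ ≤ (3 * e10 + 11 * e5) * ((e30 + e5) * W) :=
          mul_le_mul (by linarith) (hinv.trans h1B) hi0 (by positivity)
      _ = (3 * e10 + 11 * e5) * (e30 + e5) * W := by ring
  -- t1: `3 Bw log(α₁/α₀) ≤ 3 e30 W`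
  have ht1 : 3 * Bw * Real.log (α₁ / α₀) ≤ 3 * e30 * W := by
    rcases le_or_gt Bw 1 with hB1 | hB1
    · -- `α₁ = 1`
      have hα₁1 : α₁ = 1 := min_eq_left (by rw [le_one_div (by norm_num) hBw0]; simpa using hB1)
      have hlog : Real.log (α₁ / α₀) = Real.log 2 + Real.log ℓ := by
        rw [hα₁1, hα₀, one_div_one_div]
        exact Real.log_mul (by norm_num) hℓ0.ne'
      have hlog0 : 0 ≤ Real.log 2 + Real.log ℓ := by
        have := Real.log_pos (show (1:ℝ) < 2 by norm_num); linarith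
      have hl2 : Real.log 2 < 1 := by have := Real.log_two_lt_d9; linarith
      rw [hlog]
      calc 3 * Bw * (Real.log 2 + Real.log ℓ) ≤ 3 * 1 * (1 + Real.log ℓ) := by gcongr
        _ ≤ 3 * (e30 * W) := by linarith
        _ = 3 * e30 * W := by ring
    · -- `α₁ = 1/Bw`, `log(α₁/α₀) = log 2 + M - 5`
      have hα₁B : α₁ = 1 / Bw := min_eq_right (by rw [div_le_one hBw0]; exact hB1.le)
      have hlog : Real.log (α₁ / α₀) = Real.log 2 + M - 5 := by
        have hq : α₁ / α₀ = 2 * Real.exp M / e5 := by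
          rw [hα₁B, hα₀, hBw, Real.exp_neg]
          field_simp
        rw [hq, Real.log_div (by positivity) he5pos.ne', Real.log_mul (by norm_num) (Real.exp_pos M).ne',
          Real.log_exp, he5, Real.log_exp]
      have hl2 : Real.log 2 < 1 := by have := Real.log_two_lt_d9; linarith
      have hMΦ : M * Real.exp (-M) ≤ Φ := by
        have : Φ = M * Real.exp (-M) + Real.exp (-M) := by rw [hΦ]; ring
        rw [this]; linarith
      rw [hlog]
      calc 3 * Bw * (Real.log 2 + M - 5) ≤ 3 * Bw * M := by
            have : Real.log 2 + M - 5 ≤ M := by linarith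
            exact mul_le_mul_of_nonneg_left this (by positivity)
        _ = 3 * e5 * ((M * Real.exp (-M)) * ℓ) := by rw [hBw]; ring
        _ ≤ 3 * e5 * (Φ * ℓ) := by gcongr
        _ ≤ 3 * e5 * W := by gcongr
        _ ≤ 3 * e30 * W := by gcongr
  -- assemble
  have hsum : 17 * (3 * Bw * Real.log (α₁ / α₀) + 12 * e5 * ℓ / T + E' / α₀ + (3 * e10 + E') / α₁) +
      (Real.log ℓ + 1) + |C₂| ≤ K * W := by
    have hrest : 0 ≤ e5 * W := by positivity
    have : 17 * (3 * Bw * Real.log (α₁ / α₀) + 12 * e5 * ℓ / T + E' / α₀ + (3 * e10 + E') / α₁) +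
        (Real.log ℓ + 1) + |C₂| ≤
        (17 * (3 * e30 + 12 * e5 + 33 * e5 + (3 * e10 + 11 * e5) * (e30 + e5)) + e30 + |C₂| * e30) * W := by
      linarith [ht1, ht2, ht3, ht4, ht5, ht6]
    refine this.trans ?_
    rw [hK]
    linarith
  -- from `‖S‖ log x ≤ x ∫ normSExp + C₂ x`
  have hmain : ‖S g x‖ * ℓ ≤ x * (K * W) := by
    have h1 : ∫ u in Real.log 2..Real.log x, normSExp g u ≤
        17 * (3 * Bw * Real.log (α₁ / α₀) + 12 * e5 * ℓ / T + E' / α₀ + (3 * e10 + E') / α₁) +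
          (Real.log ℓ + 1) := by
      refine hB1.trans ?_
      have : (∫ α in Set.Ioc (1 / (2 * Real.log x)) 1, I α) ≤
          3 * Bw * Real.log (α₁ / α₀) + 12 * e5 * ℓ / T + E' / α₀ + (3 * e10 + E') / α₁ := hB3
      simp only [hI] at this
      gcongr
    calc ‖S g x‖ * ℓ ≤ x * (∫ u in Real.log 2..Real.log x, normSExp g u) + C₂ * x := hII
      _ ≤ x * (17 * (3 * Bw * Real.log (α₁ / α₀) + 12 * e5 * ℓ / T + E' / α₀ + (3 * e10 + E') / α₁) +
          (Real.log ℓ + 1)) + |C₂| * x := by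
          gcongr
          exact le_abs_self C₂
      _ = x * (17 * (3 * Bw * Real.log (α₁ / α₀) + 12 * e5 * ℓ / T + E' / α₀ + (3 * e10 + E') / α₁) +
          (Real.log ℓ + 1) + |C₂|) := by ring
      _ ≤ x * (K * W) := by gcongr
  have hfin : ‖S g x‖ ≤ x * (K * W) / ℓ := by rw [le_div_iff₀ hℓ0]; exact hmain
  refine hfin.trans (le_of_eq ?_)
  rw [hW]
  field_simp

end Halasz

end Literature.NumberTheory.LFunctions
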